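/-
Copyright (c) 2026 the pub-hodgecm-mathlib formalisation cell (harness21).  Prover seat hodgecm-mathlib-A-p17 (g20), floor 0, programme P5
(Alb-CM), in-house road for the letter L4if (ROAD CARD v3 §8, A-p18 (g23)), recipe STEP 3, file 2 of 2.  KERNEL module: THEOREMS ONLY
(no definition, no named fact, no `sorry`, no instance, no notation).
-/
import Summits.HodgeConjecture.HodgeConjecture.Theorems.F0P5CurveThetaCompanionDetTwistCoinvariants
import HarnessLib

/-!
# F0 · P5 pay-down line `Cruxes/HLiu418/Lines/F0_P5_CurveThetaLettersPaydown` (ED. 7), letter L4if, recipe step 3 (file 2 of 2):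
# `Θ_{ξ′}(Λᶜ·χ̌, a) ≅ (χ_{v,f} ∘ det) ⊗ Θ_ξ(Λᶜ, a)` on the members' twisted coinvariants, `ξ′ = χ_v^N · ξ`

Cell `hodgecm-mathlib`, floor 0, programme P5 (Alb-CM); crux item `stmt-HodgeConjecture-24832`
(`Summit.HodgeConjecture.HodgeConjecture.Theses.HCCMUnconditional.HLiu418`).  Sequel of ★ `F0P5CurveThetaCompanionDetTwistCoinvariants` (§1 generic
descent, §3 the twist datum `α₀(u) = χ(u_f)`) and ★ `F0P5CurveThetaCompanionLocalDetTwist` (B2, generic in `(θ, α)`); step 3 of the assembler's recipe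
(road card `F0/P5/A-p18/g23/ROAD-L4if-v3.A-p18g23.md` §8) for the last local letter of #74, `Liu2021.LemD1RankTwoCMLetters.LemD1_4IfAsPrintedNonsplitCM₂`:

* §4 **B2 at the companion pair `(Λᶜ, Λ′ = Λᶜ·χ̌)`** (`omegaLoc_companion_galConj_eq_alphaChi_det_smul`): for conjugate-symplectic `λ, λ′` with
  `Λ′ = Λᶜ·χ̌`, the twist datum `α₀` of `χ`, a line `a ∈ L⁺ˣ`, a finite place `v`: the local Weil factors of the CM θ-packages of `Λ′` and `Λᶜ` on
  `⟨T_W(a)⟩` — typed EXACTLY as the members of ★ `LemD1_4IfAsPrintedNonsplitCM₂` — satisfy `(𝓢_Λ′,a).omegaLoc v (k ⊗ 1) Φ = α₀((det k)_v) •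
  (𝓢_Λᶜ,a).omegaLoc v (k ⊗ 1) Φ` (B2 at `θ := Λᶜ`, `θ′ := Λᶜ·α̃₀`, (T1′) `α̃₀ = χ̌`);
* §5 **STEP 3** (`exists_coinv_equiv_companion_galConj`): for centre characters `ξ′ = χ_v^{N′}·ξ` of `U(J_W(a))(L⁺_v) = L_v¹`,
  `∃ T : Coinv(ω_{Λ′,a,v} ∘ (z·1_n), ξ′) ≃ₗ[ℂ] Coinv(ω_{Λᶜ,a,v} ∘ (z·1_n), ξ)` with `T ∘ Θ_{Λ′,ξ′}(k) = α₀((det k)_v) • Θ_{Λᶜ,ξ}(k) ∘ T` for every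
  `k ∈ U(diag dV)(L⁺_v)`, `Θ_{·,ξ}(k) = TwistedCoinv.rep ξ (ω_v) _ (k ⊗ 1)` the local factors of ★ `quotEquivLocalType₂`.  At `N′ = 2`, `ξ′ := χ_v`
  this forces `ξ = χ_v⁻¹ = χ_v ∘ bar₁`, the left centre character of ★ (C4b) `exists_coinv_equiv_galConj_similitude_models`
  (`Θ_{ξ∘bar₁}(Λᶜ, −a) ≅ (ξ∘det⁻¹) ⊗ Θ_ξ(Λ, (det T_a)⁻¹a)`), whose multiplier `ξ((det g)⁻¹·1)` cancels `α₀((det k)_v) = χ((det k)_{v,f})` — the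
  assembler's cancellation (recipe step 3) is then ★ `TwistedCoinv.exists_conj_twisted_intertwiner`-type glue.

HONEST LABEL: HC_CM is proved only modulo the printed citations — the 2 remaining named inputs (hLiu418, h413) — until rung 0 closes; this
file proves helper lemmas toward ONE registered letter stub (L4if) of ONE floor-0 pay-down line and discharges no letter by itself (the class
bookkeeping (C5), the model retypings (C4a) and the `AreIsomorphicRep` assembly are the assembler's, steps 1–2, 4–5).

## References
* [Liu2021] Y. Liu, *Fourier–Jacobi cycles and arithmetic relative trace formula*, Camb. J. Math. 9 (2021) = arXiv:2102.11518: App. D §D.1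
  (l. 5224), Steps 2–3 (l. 5219–5221), Lem. D.1 (4) (p. 126, l. 5235).
* [GelbartRogawski1991] S. Gelbart, J. Rogawski, Invent. Math. 105 (1991), §3.1 Prop. 3.1.1 p. 455 L1–3, Remark p. 457 L4–13.
* [HarrisKudlaSweet1996] M. Harris, S. Kudla, W. J. Sweet, *Theta dichotomy for unitary groups*, J. AMS 9 (1996), §1 (1.14)–(1.15).
* [MoeglinVignerasWaldspurger1987] LNM 1291 (1987), Chap. 2 II.2, Chap. 3 IV.
-/

set_option autoImplicit false
set_option linter.dupNamespace false

noncomputable section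

open NumberField NumberField.InfinitePlace NumberField.mixedEmbedding IsDedekindDomain
open scoped Matrix Kronecker ComplexOrder RestrictedProduct Classical
open Literature.NumberTheory.Automorphic Literature.NumberTheory.Automorphic.UnitaryGroup
open Literature.NumberTheory.Automorphic.Liu2021 Literature.NumberTheory.Automorphic.Liu2021.Def411WeilCarriers
open Literature.NumberTheory.Automorphic.Liu2021.Def411WeilCarriersDoubling
open Literature.NumberTheory.GaloisRepresentations Literature.NumberTheory.Automorphic.IdeleClassGroup
open Literature.NumberTheory.GelbartRogawski1991 Literature.NumberTheory.GelbartRogawski1991.UnitaryDualPair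
open Literature.NumberTheory.GelbartRogawski1991.UnitaryDualPair.WeilCoinv
open Literature.NumberTheory.GelbartRogawski1991.UnitaryDualPair.LocalSplitting
open Literature.NumberTheory.GelbartRogawski1991.GRConstruction
open Literature.NumberTheory.GelbartRogawski1991.GRConstruction.DoubledWeilDetTwist
open Literature.NumberTheory.Weil1964
open Literature.RepresentationTheory (TwistedCoinv.Coinv TwistedCoinv.rep TwistedCoinv.mapEquiv TwistedCoinv.mapEquiv_rep)
open Literature.RepresentationTheory.Liu2021 Literature.RepresentationTheory.HarrisKudlaSweet1996

namespace Summit.HodgeConjecture.HodgeConjecture.Cruxes.HLiu418.F0P5CurveThetaCompanionDetTwist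
/-! ## §4 B2 at the companion pair `(Λᶜ, Λ′ = Λᶜ·χ̌)`: `ω_{Λ′,a,v}(k ⊗ 1) = χ((det k)_{v,f}) • ω_{Λᶜ,a,v}(k ⊗ 1)` at the CM packages -/

section CompanionGalConj

variable (L : Type) [Field L] [NumberField L] [IsCMField L]
variable {N' : ℕ} (dV : Fin N' → L) (hdV : ∀ i, IsCMField.complexConj L (dV i) = dV i) (hdV0 : ∀ i, dV i ≠ 0)
  (hJdet : (Matrix.diagonal dV).det ≠ 0)
  (hcc : IsCMField.complexConj L * IsCMField.complexConj L = 1)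
  {n' : ℕ} (e₁ : Fin N' × Fin 1 ≃ Fin n')
  (lam : Literature.NumberTheory.Automorphic.IdeleClassGroup L →ₜ* Circle) (hlam : IsConjugateSymplectic L lam)
  (χ : Chi (Fp L) L (IsCMField.complexConj L))
  (lam' : Literature.NumberTheory.Automorphic.IdeleClassGroup L →ₜ* Circle) (hlam' : IsConjugateSymplectic L lam')
  (hH : toHeckeCharacter L lam' =
    toHeckeCharacter L (IdeleClassGroup.galConj (IsCMField.complexConj L) lam) * HeckeCharacter.checkOfChi hcc χ)
  (α₀ : UnitaryGroup.adelicOne (Fp L) L (IsCMField.complexConj L) →* ℂˣ)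
  (hα₀ : ∀ u, α₀ u = χ.1 ⟨finitePart L (u : ideleGroup L), finitePart_mem_finAdelicOne (Fp L) L (IsCMField.complexConj L) u.2⟩)

include hH hα₀ in
set_option maxHeartbeats 800000 in
-- instantiation of ★ `omegaLoc_localLineInl_eq_detTwist_smul_of_mul_ratioHecke` at the CM packages (as ★ `omegaLoc_companion_eq_detTwist_smul`, same band)
/-- **B2 AT THE COMPANION PAIR `(Λᶜ, Λ′)` — the version that CANCELS against ★ (C4b).**  For a CM field `L`, a real non-zero frame `dV`,
conjugate-symplectic `λ, λ′` with `Λ′ = Λᶜ·χ̌` ([Liu2021, Lem. D.1 (4)]'s companion label), the twist datum `α₀(u) = χ(u_f)` (§3), a line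
`a ∈ L⁺ˣ`, a finite place `v` (split or not), `k ∈ U(diag dV)(L⁺_v)`, `Φ ∈ 𝒮((L⁺_v)^{n′})`: the local Weil factors of the CM θ-packages of `Λ′` and of
`Λᶜ` on the line `⟨T_W(a)⟩` (typed EXACTLY as the members of ★ `LemD1RankTwoCMLetters.LemD1_4IfAsPrintedNonsplitCM₂`, with `Λᶜ` a splitting character by
★ `IsConjugateSymplectic.galConj`) satisfy `(𝓢_Λ′,a).omegaLoc v (k ⊗ 1) Φ = α₀((det k)_v) • (𝓢_Λᶜ,a).omegaLoc v (k ⊗ 1) Φ` — B2 (★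
`omegaLoc_localLineInl_eq_detTwist_smul_of_mul_ratioHecke`, generic in `(θ, α)`) at `θ := Λᶜ`, `θ′ := Λ′ = Λᶜ·α̃₀` ((T1′) §3).  NOT the R2G datum
`α = Λ⁻¹χ_f` of ★ `omegaLoc_companion_eq_detTwist_smul` (that one relates `Λ′` to `Λ`).
[cite: Liu2021, App. D §D.1 (l. 5224), Step 2 (l. 5219), Lem. D.1 (4) (p. 126, l. 5235)] [cite: GelbartRogawski1991, §3.1 Prop. 3.1.1 p. 455 L1–3, Remark p. 457 L4–13]
[cite: HarrisKudlaSweet1996, §1 (1.14)–(1.15)] -/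
theorem omegaLoc_companion_galConj_eq_alphaChi_det_smul (a : (Fp L)ˣ) (v : HeightOneSpectrum (𝓞 (Fp L)))
    (k : UnitaryGroup.localPi L (IsCMField.complexConj L) N' (Matrix.diagonal dV) v)
    (Φ : SchwartzBruhat (Fin n' → v.adicCompletion (Fp L))) :
    (congrW L e₁ dV hdV (lineW L (TW (Fp L) a)) (complexConj_lineW L (TW (Fp L) a)) (realDiagonal_lineW L (TW (Fp L) a))
        (diagonal_lineW L (TW (Fp L) a) (JW_eq (Fp L) L a))
        (undoubledSplittings L e₁ dV hdV hdV0 (lineW L (TW (Fp L) a)) (complexConj_lineW L (TW (Fp L) a))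
          (lineW_ne_zero L (TW (Fp L) a) (isUnit_det_TW (Fp L) a)) (toHeckeCharacter L lam') (borelPlaceMeasure L)
          (cmFinLocalFamily L e₁ dV hdV hdV0 (lineW L (TW (Fp L) a)) (complexConj_lineW L (TW (Fp L) a))
            (lineW_ne_zero L (TW (Fp L) a) (isUnit_det_TW (Fp L) a)) (toHeckeCharacter L lam')
            ((isOscillatorChar_toHeckeCharacter_iff lam').mpr hlam') (borelPlaceMeasure L)))
        (isSymm_TW (Fp L) a) (JW_eq (Fp L) L a)).omegaLoc v
        (UnitaryGroup.localLineInl L (IsCMField.complexConj L) N' e₁ (Matrix.diagonal dV) (JW (Fp L) L a) v k) Φ =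
      ((α₀ (UnitaryGroup.adelicDet (Fp L) L (IsCMField.complexConj L) N' (Matrix.diagonal dV) hJdet
            (UnitaryGroup.finAdelicToAdelic (Fp L) L (IsCMField.complexConj L) N' (Matrix.diagonal dV)
              (UnitaryGroup.inclPlace (Fp L) L (IsCMField.complexConj L) N' (Matrix.diagonal dV) v k))) : ℂˣ) : ℂ) •
        (congrW L e₁ dV hdV (lineW L (TW (Fp L) a)) (complexConj_lineW L (TW (Fp L) a)) (realDiagonal_lineW L (TW (Fp L) a))
        (diagonal_lineW L (TW (Fp L) a) (JW_eq (Fp L) L a))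
        (undoubledSplittings L e₁ dV hdV hdV0 (lineW L (TW (Fp L) a)) (complexConj_lineW L (TW (Fp L) a))
          (lineW_ne_zero L (TW (Fp L) a) (isUnit_det_TW (Fp L) a)) (toHeckeCharacter L (IdeleClassGroup.galConj (IsCMField.complexConj L) lam)) (borelPlaceMeasure L)
          (cmFinLocalFamily L e₁ dV hdV hdV0 (lineW L (TW (Fp L) a)) (complexConj_lineW L (TW (Fp L) a))
            (lineW_ne_zero L (TW (Fp L) a) (isUnit_det_TW (Fp L) a)) (toHeckeCharacter L (IdeleClassGroup.galConj (IsCMField.complexConj L) lam))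
            ((isOscillatorChar_toHeckeCharacter_iff _).mpr hlam.galConj) (borelPlaceMeasure L)))
        (isSymm_TW (Fp L) a) (JW_eq (Fp L) L a)).omegaLoc v
          (UnitaryGroup.localLineInl L (IsCMField.complexConj L) N' e₁ (Matrix.diagonal dV) (JW (Fp L) L a) v k) Φ := by
  -- the three side conditions of the twist datum (§3) and (T1′)
  have hc : Continuous α₀ := continuous_alphaChi α₀ hα₀
  have hrat : ∀ u : UnitaryGroup.adelicOne (Fp L) L (IsCMField.complexConj L),
      (u : ideleGroup L) ∈ principalIdeles L → α₀ u = 1 := alphaChi_eq_one_of_mem_principalIdeles α₀ hα₀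
  have hαu : ∀ u, ‖((α₀ u : ℂˣ) : ℂ)‖ = 1 := norm_alphaChi α₀ hα₀
  have hΛ : toHeckeCharacter L lam' =
      toHeckeCharacter L (IdeleClassGroup.galConj (IsCMField.complexConj L) lam) * ratioHecke L α₀ hc hrat :=
    hH.trans (toHeckeCharacter_galConj_mul_checkOfChi_eq_mul_ratioHecke_alphaChi α₀ hα₀ lam hcc hc hrat)
  exact omegaLoc_localLineInl_eq_detTwist_smul_of_mul_ratioHecke L e₁ dV hdV hdV0 hJdet
    (toHeckeCharacter L (IdeleClassGroup.galConj (IsCMField.complexConj L) lam))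
    (isUnitary_toHeckeCharacter L _) ((isOscillatorChar_toHeckeCharacter_iff _).mpr hlam.galConj) hc hrat hαu
    (toHeckeCharacter L lam') (isUnitary_toHeckeCharacter L lam') ((isOscillatorChar_toHeckeCharacter_iff lam').mpr hlam')
    (TW (Fp L) a) (isSymm_TW (Fp L) a) (isUnit_det_TW (Fp L) a) (JW (Fp L) L a) (JW_eq (Fp L) L a) (borelPlaceMeasure L) (borelPlaceMeasure L)
    _ _ hΛ v k Φ

end CompanionGalConj

/-! ## §5 STEP 3 OF THE ROAD: `Θ_{ξ′}(Λ′, a) ≅ (α₀,v ∘ det) ⊗ Θ_ξ(Λᶜ, a)` on the members' twisted coinvariants, `ξ′ = χ_v^N · ξ` -/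

section CompanionCoinv

variable (L : Type) [Field L] [NumberField L] [IsCMField L]
variable {N' : ℕ} (dV : Fin N' → L) (hdV : ∀ i, IsCMField.complexConj L (dV i) = dV i) (hdV0 : ∀ i, dV i ≠ 0)
  (hJdet : (Matrix.diagonal dV).det ≠ 0)
  (hcc : IsCMField.complexConj L * IsCMField.complexConj L = 1)
  {n' : ℕ} (e₁ : Fin N' × Fin 1 ≃ Fin n')
  (lam : Literature.NumberTheory.Automorphic.IdeleClassGroup L →ₜ* Circle) (hlam : IsConjugateSymplectic L lam)
  (χ : Chi (Fp L) L (IsCMField.complexConj L))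
  (lam' : Literature.NumberTheory.Automorphic.IdeleClassGroup L →ₜ* Circle) (hlam' : IsConjugateSymplectic L lam')
  (hH : toHeckeCharacter L lam' =
    toHeckeCharacter L (IdeleClassGroup.galConj (IsCMField.complexConj L) lam) * HeckeCharacter.checkOfChi hcc χ)
  (α₀ : UnitaryGroup.adelicOne (Fp L) L (IsCMField.complexConj L) →* ℂˣ)
  (hα₀ : ∀ u, α₀ u = χ.1 ⟨finitePart L (u : ideleGroup L), finitePart_mem_finAdelicOne (Fp L) L (IsCMField.complexConj L) u.2⟩)

include hH hα₀ in
set_option maxHeartbeats 4800000 in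
-- measured (1.6 M, 2.4 M] on the check farm (fails at 1.6 M, passes at 2.4 M); 4.8 M = 2× head-room for the build lane (g19 lesson B38-N15).  Cost is the
-- STATEMENT (two `TwistedCoinv.rep … (commute_omegaLoc_localCenter …)` readings at the spelled CM packages) + the one `exact` of §1 against it.
/-- **STEP 3 (ROAD CARD v3 §8) — B2 DESCENDED TO THE MEMBERS' TWISTED COINVARIANTS, at the companion pair `(Λᶜ, Λ′)`.**  Data as in §4; a line
`a ∈ L⁺ˣ`, a finite place `v`, and two characters `ξ, ξ′` of the centre `U(J_W(a))(L⁺_v) = L_v¹` with **`ξ′(z) = χ_v(z)^{N′} · ξ(z)`**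
(`χ_v = localCharOfCenter … (J_W a) χ v`, the letter's centre character).  Then
`∃ T : Coinv(ω_{Λ′,a,v} ∘ (z·1_n), ξ′) ≃ₗ[ℂ] Coinv(ω_{Λᶜ,a,v} ∘ (z·1_n), ξ)` with, for every `k ∈ U(diag dV)(L⁺_v)`,
**`T ∘ Θ_{Λ′,ξ′}(k) = α₀((det k)_v) • Θ_{Λᶜ,ξ}(k) ∘ T`**, `Θ_{·,ξ}(k) = TwistedCoinv.rep ξ (ω_v) _ (k ⊗ 1)` — the local factors of ★
`quotEquivLocalType₂` ∕ `areIsomorphicRep_localType₂_iff_quot`; i.e. «`Θ_{ξ′}(λᶜχ̌, a) ≅ (χ_{v,f} ∘ det) ⊗ Θ_ξ(λᶜ, a)`».  At `N′ = 2`, `ξ′ := χ_v` this forces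
`ξ = χ_v⁻¹ = χ_v ∘ bar₁`, the left centre character of ★ (C4b) `exists_coinv_equiv_galConj_similitude_models`, whose multiplier `ξ((det g)⁻¹·1)`
cancels `α₀((det k)_v) = χ((det k)_{v,f})` (recipe step 3).  Proof: §1 at `c(k) = α₀((det k)_v)` with §4, the centre reading §3
`alphaChi_adelicDet_inclPlace_localCenter`. [cite: Liu2021, App. D §D.1 Step 3 (l. 5221), Lem. D.1 (4) (p. 126, l. 5235)]
[cite: GelbartRogawski1991, §3.1 Prop. 3.1.1 p. 455 L1–3, Remark p. 457 L4–13] [cite: MoeglinVignerasWaldspurger1987, Chap. 2 II.2, Chap. 3 IV] -/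
theorem exists_coinv_equiv_companion_galConj (a : (Fp L)ˣ) (v : HeightOneSpectrum (𝓞 (Fp L)))
    (ξ ξ' : UnitaryGroup.localPi L (IsCMField.complexConj L) 1 (JW (Fp L) L a) v →* ℂˣ)
    (hξ : ∀ z, ξ' z = localCharOfCenter (Fp L) L (IsCMField.complexConj L) (JW (Fp L) L a) (JW_apply_ne_zero (Fp L) L a) χ.1 v z ^ N' * ξ z) :
    ∃ T : TwistedCoinv.Coinv (show Representation ℂ (UnitaryGroup.localPi L (IsCMField.complexConj L) 1 (JW (Fp L) L a) v)
            (SchwartzBruhat (Fin n' → v.adicCompletion (Fp L))) from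
          ((congrW L e₁ dV hdV (lineW L (TW (Fp L) a)) (complexConj_lineW L (TW (Fp L) a)) (realDiagonal_lineW L (TW (Fp L) a))
            (diagonal_lineW L (TW (Fp L) a) (JW_eq (Fp L) L a))
            (undoubledSplittings L e₁ dV hdV hdV0 (lineW L (TW (Fp L) a)) (complexConj_lineW L (TW (Fp L) a))
              (lineW_ne_zero L (TW (Fp L) a) (isUnit_det_TW (Fp L) a)) (toHeckeCharacter L lam') (borelPlaceMeasure L)
              (cmFinLocalFamily L e₁ dV hdV hdV0 (lineW L (TW (Fp L) a)) (complexConj_lineW L (TW (Fp L) a))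
                (lineW_ne_zero L (TW (Fp L) a) (isUnit_det_TW (Fp L) a)) (toHeckeCharacter L lam')
                ((isOscillatorChar_toHeckeCharacter_iff lam').mpr hlam') (borelPlaceMeasure L)))
            (isSymm_TW (Fp L) a) (JW_eq (Fp L) L a)).omegaLoc v).comp
          (localCenter L (IsCMField.complexConj L) n' (Matrix.reindex e₁ e₁ (Matrix.diagonal dV ⊗ₖ JW (Fp L) L a)) (JW (Fp L) L a)
            (JW_apply_ne_zero (Fp L) L a) v)) ξ' ≃ₗ[ℂ]
        TwistedCoinv.Coinv (show Representation ℂ (UnitaryGroup.localPi L (IsCMField.complexConj L) 1 (JW (Fp L) L a) v)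
            (SchwartzBruhat (Fin n' → v.adicCompletion (Fp L))) from
          ((congrW L e₁ dV hdV (lineW L (TW (Fp L) a)) (complexConj_lineW L (TW (Fp L) a)) (realDiagonal_lineW L (TW (Fp L) a))
            (diagonal_lineW L (TW (Fp L) a) (JW_eq (Fp L) L a))
            (undoubledSplittings L e₁ dV hdV hdV0 (lineW L (TW (Fp L) a)) (complexConj_lineW L (TW (Fp L) a))
              (lineW_ne_zero L (TW (Fp L) a) (isUnit_det_TW (Fp L) a)) (toHeckeCharacter L (IdeleClassGroup.galConj (IsCMField.complexConj L) lam)) (borelPlaceMeasure L)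
              (cmFinLocalFamily L e₁ dV hdV hdV0 (lineW L (TW (Fp L) a)) (complexConj_lineW L (TW (Fp L) a))
                (lineW_ne_zero L (TW (Fp L) a) (isUnit_det_TW (Fp L) a)) (toHeckeCharacter L (IdeleClassGroup.galConj (IsCMField.complexConj L) lam))
                ((isOscillatorChar_toHeckeCharacter_iff _).mpr hlam.galConj) (borelPlaceMeasure L)))
            (isSymm_TW (Fp L) a) (JW_eq (Fp L) L a)).omegaLoc v).comp
          (localCenter L (IsCMField.complexConj L) n' (Matrix.reindex e₁ e₁ (Matrix.diagonal dV ⊗ₖ JW (Fp L) L a)) (JW (Fp L) L a)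
            (JW_apply_ne_zero (Fp L) L a) v)) ξ,
      ∀ (k : UnitaryGroup.localPi L (IsCMField.complexConj L) N' (Matrix.diagonal dV) v)
        (y : TwistedCoinv.Coinv (show Representation ℂ (UnitaryGroup.localPi L (IsCMField.complexConj L) 1 (JW (Fp L) L a) v)
            (SchwartzBruhat (Fin n' → v.adicCompletion (Fp L))) from
          ((congrW L e₁ dV hdV (lineW L (TW (Fp L) a)) (complexConj_lineW L (TW (Fp L) a)) (realDiagonal_lineW L (TW (Fp L) a))
            (diagonal_lineW L (TW (Fp L) a) (JW_eq (Fp L) L a))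
            (undoubledSplittings L e₁ dV hdV hdV0 (lineW L (TW (Fp L) a)) (complexConj_lineW L (TW (Fp L) a))
              (lineW_ne_zero L (TW (Fp L) a) (isUnit_det_TW (Fp L) a)) (toHeckeCharacter L lam') (borelPlaceMeasure L)
              (cmFinLocalFamily L e₁ dV hdV hdV0 (lineW L (TW (Fp L) a)) (complexConj_lineW L (TW (Fp L) a))
                (lineW_ne_zero L (TW (Fp L) a) (isUnit_det_TW (Fp L) a)) (toHeckeCharacter L lam')
                ((isOscillatorChar_toHeckeCharacter_iff lam').mpr hlam') (borelPlaceMeasure L)))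
            (isSymm_TW (Fp L) a) (JW_eq (Fp L) L a)).omegaLoc v).comp
          (localCenter L (IsCMField.complexConj L) n' (Matrix.reindex e₁ e₁ (Matrix.diagonal dV ⊗ₖ JW (Fp L) L a)) (JW (Fp L) L a)
            (JW_apply_ne_zero (Fp L) L a) v)) ξ'),
        T (TwistedCoinv.rep ξ' ((congrW L e₁ dV hdV (lineW L (TW (Fp L) a)) (complexConj_lineW L (TW (Fp L) a)) (realDiagonal_lineW L (TW (Fp L) a))
            (diagonal_lineW L (TW (Fp L) a) (JW_eq (Fp L) L a))
            (undoubledSplittings L e₁ dV hdV hdV0 (lineW L (TW (Fp L) a)) (complexConj_lineW L (TW (Fp L) a))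
              (lineW_ne_zero L (TW (Fp L) a) (isUnit_det_TW (Fp L) a)) (toHeckeCharacter L lam') (borelPlaceMeasure L)
              (cmFinLocalFamily L e₁ dV hdV hdV0 (lineW L (TW (Fp L) a)) (complexConj_lineW L (TW (Fp L) a))
                (lineW_ne_zero L (TW (Fp L) a) (isUnit_det_TW (Fp L) a)) (toHeckeCharacter L lam')
                ((isOscillatorChar_toHeckeCharacter_iff lam').mpr hlam') (borelPlaceMeasure L)))
            (isSymm_TW (Fp L) a) (JW_eq (Fp L) L a)).omegaLoc v)
              (commute_omegaLoc_localCenter (Fp L) L (IsCMField.complexConj L) N' e₁ (Matrix.diagonal dV) (JW (Fp L) L a)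
                (complexConj_imagUnit L) (imagUnit_ne_zero L) (imagUnit_mul_self L) (realDiagonal_isSymm L dV hdV) (isSymm_TW (Fp L) a)
                (realDiagonal_map L dV hdV).symm (JW_eq (Fp L) L a) (JW_apply_ne_zero (Fp L) L a)
                (congrW L e₁ dV hdV (lineW L (TW (Fp L) a)) (complexConj_lineW L (TW (Fp L) a)) (realDiagonal_lineW L (TW (Fp L) a))
            (diagonal_lineW L (TW (Fp L) a) (JW_eq (Fp L) L a))
            (undoubledSplittings L e₁ dV hdV hdV0 (lineW L (TW (Fp L) a)) (complexConj_lineW L (TW (Fp L) a))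
              (lineW_ne_zero L (TW (Fp L) a) (isUnit_det_TW (Fp L) a)) (toHeckeCharacter L lam') (borelPlaceMeasure L)
              (cmFinLocalFamily L e₁ dV hdV hdV0 (lineW L (TW (Fp L) a)) (complexConj_lineW L (TW (Fp L) a))
                (lineW_ne_zero L (TW (Fp L) a) (isUnit_det_TW (Fp L) a)) (toHeckeCharacter L lam')
                ((isOscillatorChar_toHeckeCharacter_iff lam').mpr hlam') (borelPlaceMeasure L)))
            (isSymm_TW (Fp L) a) (JW_eq (Fp L) L a)) v)
              (UnitaryGroup.localLineInl L (IsCMField.complexConj L) N' e₁ (Matrix.diagonal dV) (JW (Fp L) L a) v k) y) =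
          ((α₀ (UnitaryGroup.adelicDet (Fp L) L (IsCMField.complexConj L) N' (Matrix.diagonal dV) hJdet
              (UnitaryGroup.finAdelicToAdelic (Fp L) L (IsCMField.complexConj L) N' (Matrix.diagonal dV)
                (UnitaryGroup.inclPlace (Fp L) L (IsCMField.complexConj L) N' (Matrix.diagonal dV) v k))) : ℂˣ) : ℂ) •
            TwistedCoinv.rep ξ ((congrW L e₁ dV hdV (lineW L (TW (Fp L) a)) (complexConj_lineW L (TW (Fp L) a)) (realDiagonal_lineW L (TW (Fp L) a))
            (diagonal_lineW L (TW (Fp L) a) (JW_eq (Fp L) L a))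
            (undoubledSplittings L e₁ dV hdV hdV0 (lineW L (TW (Fp L) a)) (complexConj_lineW L (TW (Fp L) a))
              (lineW_ne_zero L (TW (Fp L) a) (isUnit_det_TW (Fp L) a)) (toHeckeCharacter L (IdeleClassGroup.galConj (IsCMField.complexConj L) lam)) (borelPlaceMeasure L)
              (cmFinLocalFamily L e₁ dV hdV hdV0 (lineW L (TW (Fp L) a)) (complexConj_lineW L (TW (Fp L) a))
                (lineW_ne_zero L (TW (Fp L) a) (isUnit_det_TW (Fp L) a)) (toHeckeCharacter L (IdeleClassGroup.galConj (IsCMField.complexConj L) lam))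
                ((isOscillatorChar_toHeckeCharacter_iff _).mpr hlam.galConj) (borelPlaceMeasure L)))
            (isSymm_TW (Fp L) a) (JW_eq (Fp L) L a)).omegaLoc v)
              (commute_omegaLoc_localCenter (Fp L) L (IsCMField.complexConj L) N' e₁ (Matrix.diagonal dV) (JW (Fp L) L a)
                (complexConj_imagUnit L) (imagUnit_ne_zero L) (imagUnit_mul_self L) (realDiagonal_isSymm L dV hdV) (isSymm_TW (Fp L) a)
                (realDiagonal_map L dV hdV).symm (JW_eq (Fp L) L a) (JW_apply_ne_zero (Fp L) L a)
                (congrW L e₁ dV hdV (lineW L (TW (Fp L) a)) (complexConj_lineW L (TW (Fp L) a)) (realDiagonal_lineW L (TW (Fp L) a))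
            (diagonal_lineW L (TW (Fp L) a) (JW_eq (Fp L) L a))
            (undoubledSplittings L e₁ dV hdV hdV0 (lineW L (TW (Fp L) a)) (complexConj_lineW L (TW (Fp L) a))
              (lineW_ne_zero L (TW (Fp L) a) (isUnit_det_TW (Fp L) a)) (toHeckeCharacter L (IdeleClassGroup.galConj (IsCMField.complexConj L) lam)) (borelPlaceMeasure L)
              (cmFinLocalFamily L e₁ dV hdV hdV0 (lineW L (TW (Fp L) a)) (complexConj_lineW L (TW (Fp L) a))
                (lineW_ne_zero L (TW (Fp L) a) (isUnit_det_TW (Fp L) a)) (toHeckeCharacter L (IdeleClassGroup.galConj (IsCMField.complexConj L) lam))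
                ((isOscillatorChar_toHeckeCharacter_iff _).mpr hlam.galConj) (borelPlaceMeasure L)))
            (isSymm_TW (Fp L) a) (JW_eq (Fp L) L a)) v)
              (UnitaryGroup.localLineInl L (IsCMField.complexConj L) N' e₁ (Matrix.diagonal dV) (JW (Fp L) L a) v k) (T y) := by
  have hξ' : ∀ z, ξ' z = α₀ (UnitaryGroup.adelicDet (Fp L) L (IsCMField.complexConj L) N' (Matrix.diagonal dV) hJdet
      (UnitaryGroup.finAdelicToAdelic (Fp L) L (IsCMField.complexConj L) N' (Matrix.diagonal dV)
        (UnitaryGroup.inclPlace (Fp L) L (IsCMField.complexConj L) N' (Matrix.diagonal dV) v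
          (localCenter L (IsCMField.complexConj L) N' (Matrix.diagonal dV) (JW (Fp L) L a) (JW_apply_ne_zero (Fp L) L a) v z)))) * ξ z :=
    fun z => by rw [alphaChi_adelicDet_inclPlace_localCenter α₀ hα₀]; exact hξ z
  exact exists_coinv_equiv_of_omegaLoc_localLineInl_eq_smul (Fp L) L (IsCMField.complexConj L) N' e₁ (Matrix.diagonal dV) (JW (Fp L) L a)
    (complexConj_imagUnit L) (imagUnit_ne_zero L) (imagUnit_mul_self L) (realDiagonal_isSymm L dV hdV) (isSymm_TW (Fp L) a)
    (realDiagonal_map L dV hdV).symm (JW_eq (Fp L) L a) (JW_apply_ne_zero (Fp L) L a)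
    (congrW L e₁ dV hdV (lineW L (TW (Fp L) a)) (complexConj_lineW L (TW (Fp L) a)) (realDiagonal_lineW L (TW (Fp L) a))
            (diagonal_lineW L (TW (Fp L) a) (JW_eq (Fp L) L a))
            (undoubledSplittings L e₁ dV hdV hdV0 (lineW L (TW (Fp L) a)) (complexConj_lineW L (TW (Fp L) a))
              (lineW_ne_zero L (TW (Fp L) a) (isUnit_det_TW (Fp L) a)) (toHeckeCharacter L (IdeleClassGroup.galConj (IsCMField.complexConj L) lam)) (borelPlaceMeasure L)
              (cmFinLocalFamily L e₁ dV hdV hdV0 (lineW L (TW (Fp L) a)) (complexConj_lineW L (TW (Fp L) a))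
                (lineW_ne_zero L (TW (Fp L) a) (isUnit_det_TW (Fp L) a)) (toHeckeCharacter L (IdeleClassGroup.galConj (IsCMField.complexConj L) lam))
                ((isOscillatorChar_toHeckeCharacter_iff _).mpr hlam.galConj) (borelPlaceMeasure L)))
            (isSymm_TW (Fp L) a) (JW_eq (Fp L) L a))
    (congrW L e₁ dV hdV (lineW L (TW (Fp L) a)) (complexConj_lineW L (TW (Fp L) a)) (realDiagonal_lineW L (TW (Fp L) a))
            (diagonal_lineW L (TW (Fp L) a) (JW_eq (Fp L) L a))
            (undoubledSplittings L e₁ dV hdV hdV0 (lineW L (TW (Fp L) a)) (complexConj_lineW L (TW (Fp L) a))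
              (lineW_ne_zero L (TW (Fp L) a) (isUnit_det_TW (Fp L) a)) (toHeckeCharacter L lam') (borelPlaceMeasure L)
              (cmFinLocalFamily L e₁ dV hdV hdV0 (lineW L (TW (Fp L) a)) (complexConj_lineW L (TW (Fp L) a))
                (lineW_ne_zero L (TW (Fp L) a) (isUnit_det_TW (Fp L) a)) (toHeckeCharacter L lam')
                ((isOscillatorChar_toHeckeCharacter_iff lam').mpr hlam') (borelPlaceMeasure L)))
            (isSymm_TW (Fp L) a) (JW_eq (Fp L) L a))
    v (fun k => α₀ (UnitaryGroup.adelicDet (Fp L) L (IsCMField.complexConj L) N' (Matrix.diagonal dV) hJdet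
              (UnitaryGroup.finAdelicToAdelic (Fp L) L (IsCMField.complexConj L) N' (Matrix.diagonal dV)
                (UnitaryGroup.inclPlace (Fp L) L (IsCMField.complexConj L) N' (Matrix.diagonal dV) v k))))
    (fun k Φ => omegaLoc_companion_galConj_eq_alphaChi_det_smul L dV hdV hdV0 hJdet hcc e₁ lam hlam χ lam' hlam' hH α₀ hα₀ a v k Φ)
    ξ ξ' hξ'

end CompanionCoinv

end Summit.HodgeConjecture.HodgeConjecture.Cruxes.HLiu418.F0P5CurveThetaCompanionDetTwist

end
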